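import Mathlib
import Literature.NumberTheory.LFunctions.Zhang2022.Section12RelCompare
import Literature.NumberTheory.LFunctions.Zhang2022.Section12Lemma122Edge
import HarnessLib

/-!
# Zhang (2022) §12, Lemma 12.2: the Cauchy steps u026 / (12.10) in the Euler-majorant currency `∏_{q∣dr}(1 + A/q)`

Topic `Literature/NumberTheory/LFunctions/Zhang2022` (Landau–Siegel audit tree; verdict-neutral).
Y. Zhang, *Discrete mean estimates and the Landau–Siegel zero*, arXiv:2211.02515v1 (2022)
[Zhang2022LandauSiegel] — **an unrefereed manuscript under adjudication**; ZHANG-L lane, WP12 (typer seat,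
task T2, referee remark zl-w12-ref-1 2026-08-27T00:32Z (R1)). THEOREMS ONLY (no new definition, no new fact);
companion of `TypedSection12BRel` (nodes `U024RelA`, `U026readRelA`, `Eq1210L15RelA`, `DedU026readRelA`,
`DedEq1210L15RelA`) and of `Section12RelCompare` (`prod_one_add_div_mono`; `Section8FrontEnd44ReductionRel.relFac_le_prod`). Kernel-checked:
`u024RelA_of_u024Rel` (`(∏(1−q⁻¹)⁻¹)² ≤ ∏(1+6/q)`), **`dedU026readRelA_holds`** (`U024RelA → U025Rel → U026readRelA`, the two
input currencies merged under `∏_{q∣dr}(1 + max(A,6)/q)`), **`dedEq1210L15RelA_holds`**, and the packaged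
`eq1210L15RelA_of_u024RelA_u025Rel`, `eq1210L15RelA_of_u024Rel_u025Rel`, plus the currency comparison
`eq1210LeRelA_of_eq1210LeRel` / `eq1210L15RelA_of_eq1210L15Rel` (so ONE consumer edge out of `Eq1210L15RelA` serves both) — the proofs of
`Sec12B.u026read_of_u024_u025` / `eq1210L15_of_steps` (sz-d60) with the factor carried as a constant in `w`.
So (12.10) in the currency (12.12) consumes holds MODULO the circle claims `U024RelA` (or `U024Rel`) and `U025Rel`.
Nothing here asserts any CLAIM, or anything about Theorems 1–2 / Landau–Siegel zeros.

## References

* Y. Zhang, arXiv:2211.02515v1 (2022), §12 Lemma 12.2 and its proof pp. 69–70 (tex L3502–L3549).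
  [cite: Zhang2022LandauSiegel, §12 Lemma 12.2]
-/

noncomputable section

open Complex Real ComplexConjugate

namespace Literature.NumberTheory.LFunctions.Zhang2022.Typed.Sec12B

open Literature.NumberTheory.LFunctions.Zhang2022.Skeleton

/-! ## The Cauchy steps of Lemma 12.2 in the Euler-majorant currency -/

section EdgesA

variable (c' : ℝ) {D : ℕ}

/-- `α = π/𝓛⁹`. [cite: Zhang2022LandauSiegel, §2 (2.10)] -/
private theorem alpha_eq_div' (D : ℕ) : alpha D = π / ell D ^ 9 := by
  rw [alpha, bigP, Real.log_exp]

/-- `α > 0` for `D ≥ 3`. [cite: Zhang2022LandauSiegel, §2 (2.10)] -/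
private theorem alpha_pos_three' (hD : 3 ≤ D) : 0 < alpha D := by
  rw [alpha_eq_div']; exact div_pos Real.pi_pos (pow_pos (by linarith [one_lt_ell hD]) _)

/-- `log P₁ = 0.504·𝓛⁹`. [cite: Zhang2022LandauSiegel, §2 (2.21)] -/
private theorem log_P1_eq_ell' (D : ℕ) : Real.log (Skeleton.P1 D) = 0.504 * ell D ^ 9 := by
  rw [Skeleton.P1, Real.log_rpow (by rw [bigP]; exact Real.exp_pos _), bigP, Real.log_exp]

/-- `log P₁ > 0` for `D ≥ 3`. [cite: Zhang2022LandauSiegel, §2 (2.21)] -/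
private theorem log_P1_pos_three' (hD : 3 ≤ D) : 0 < Real.log (Skeleton.P1 D) := by
  rw [log_P1_eq_ell']; exact mul_pos (by norm_num) (pow_pos (by linarith [one_lt_ell hD]) _)

/-- `U024Rel → U024RelA` (`(∏(1−q⁻¹)⁻¹)² ≤ ∏(1 + 6/q)`, `A := 6`). [cite: Zhang2022LandauSiegel, §12 proof of Lemma 12.2, p.69] -/
theorem u024RelA_of_u024Rel (h : U024Rel c') : U024RelA c' := by
  obtain ⟨C, hC⟩ := h
  refine ⟨|C|, 6, by norm_num, hC.mono fun D _ χ _ _ hS hA j hj d r hd hr h1 w hw => ?_⟩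
  obtain ⟨e1, e2⟩ := hS hA j hj d r hd hr h1 w hw
  have h15 : 0 ≤ (ell D ^ 15)⁻¹ := inv_nonneg.mpr (pow_nonneg (Real.log_natCast_nonneg D) 15)
  have hup : ∀ {x : ℝ}, x ≤ C * (ell D ^ 15)⁻¹ * (∏ q ∈ (d * r).primeFactors, (1 - (q : ℝ)⁻¹)⁻¹) ^ 2 →
      x ≤ |C| * (ell D ^ 15)⁻¹ * ∏ q ∈ (d * r).primeFactors, (1 + 6 / (q : ℝ)) := by
    intro x hx
    calc x ≤ C * (ell D ^ 15)⁻¹ * (∏ q ∈ (d * r).primeFactors, (1 - (q : ℝ)⁻¹)⁻¹) ^ 2 := hx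
      _ ≤ |C| * (ell D ^ 15)⁻¹ * (∏ q ∈ (d * r).primeFactors, (1 - (q : ℝ)⁻¹)⁻¹) ^ 2 :=
          mul_le_mul_of_nonneg_right (mul_le_mul_of_nonneg_right (le_abs_self C) h15)
            (le_trans zero_le_one (Section8FrontEnd44ReductionRel.one_le_relFac _))
      _ ≤ |C| * (ell D ^ 15)⁻¹ * ∏ q ∈ (d * r).primeFactors, (1 + 6 / (q : ℝ)) :=
          mul_le_mul_of_nonneg_left (Section8FrontEnd44ReductionRel.relFac_le_prod _) (mul_nonneg (abs_nonneg C) h15)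
  exact ⟨hup e1, hup e2⟩

/-- **`DedU026readRelA` holds: the Cauchy step of Lemma 12.2 in the Euler-majorant currency** — `U024RelA` (factor
`∏(1+A/q)`) and `U025Rel` (factor `(∏(1−q⁻¹)⁻¹)² ≤ ∏(1+6/q)`) combine under `∏(1 + max(A,6)/q)`, a constant in `w`,
carried through Cauchy's estimate on `|w| = α` exactly as in `dedU026readRel_holds`; constants
`e^{521π}(|C₁|+|C₂|)/π`, `A′ = max(A,6)`. [cite: Zhang2022LandauSiegel, §12 proof of Lemma 12.2, pp.69–70] -/
theorem u026readRelA_of_u024RelA_u025Rel (h24 : U024RelA c') (h25 : U025Rel c') : U026readRelA c' := by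
  obtain ⟨C₁, A, hA0, h24'⟩ := h24
  obtain ⟨C₂, h25'⟩ := h25
  obtain ⟨D₀, hall⟩ := (h24'.and h25').and (circ025_eq c')
  refine ⟨Real.exp (521 * π) * (|C₁| + |C₂|) / π, max A 6, le_trans hA0 (le_max_left _ _), max D₀ 3,
    fun D _ χ hD hq hp hA j hj d r hd hr h1 => ?_⟩
  have hD₀ : D₀ ≤ D := le_trans (le_max_left _ _) hD
  have hD3 : 3 ≤ D := le_trans (le_max_right _ _) hD
  obtain ⟨⟨k24, k25⟩, k25'⟩ := hall D χ hD₀ hq hp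
  have hα : 0 < alpha D := alpha_pos_three' hD3
  have hℓ : 0 < ell D := by linarith [one_lt_ell hD3]
  have hT : 1 ≤ bigT D := by rw [bigT]; exact Real.one_le_exp (by positivity)
  have h1' : ((d * r : ℕ) : ℝ) ≤ P1pp D := h1.trans (div_le_self (P1pp_pos hD3).le hT)
  set R : ℝ := ∏ q ∈ (d * r).primeFactors, (1 + max A 6 / (q : ℝ)) with hRdef
  have hRA : (∏ q ∈ (d * r).primeFactors, (1 + A / (q : ℝ))) ≤ R :=
    prod_one_add_div_mono _ hA0 (le_max_left _ _)
  have hR6 : (∏ q ∈ (d * r).primeFactors, (1 - (q : ℝ)⁻¹)⁻¹) ^ 2 ≤ R :=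
    (Section8FrontEnd44ReductionRel.relFac_le_prod _).trans (prod_one_add_div_mono _ (by norm_num) (le_max_right _ _))
  have hR0 : 0 ≤ R := le_trans zero_le_one (one_le_prod_one_add_div _ (le_trans hA0 (le_max_left _ _)))
  set L : ℂ := deriv χ.LFunction 1 * PiW χ d r with hL
  set B : ℂ := betaJ c' D (j + 1) * betaJ c' D (j + 2) with hB
  set E : ℂ → ℂ := fun w => bracket122 c' χ j d r w - L * B * modelInt026 D w with hE
  -- the bound on the circle
  have hcirc : ∀ w ∈ Metric.sphere (0 : ℂ) (alpha D), ‖E w‖ ≤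
      Real.exp (521 * π) * ((|C₁| + |C₂|) * (ell D ^ 15)⁻¹ * R) := by
    intro w hw
    have hw' : ‖w‖ = alpha D := by simpa using hw
    have hwlt : ‖w‖ < 1.2 * alpha D := by rw [hw']; linarith
    obtain ⟨-, e24⟩ := k24 hA j hj d r hd hr h1 w hw'
    have e25 := k25 hA j hj d r hd hr h1 w hw'
    have e25' := k25' j hj d r hd hr w hw'
    have hid : E w = ((((d * r : ℕ) : ℝ) / P1pp D : ℝ) : ℂ) ^ (beta6 D - w) *
        (innerSum c' χ j d r w - L * circ025 c' D j d r w) := by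
      have key := Xpow_mul_closedForm025 c' hD3 j d r hd hr hwlt
      rw [← e25'] at key
      simp only [hE, bracket122]
      linear_combination L * key
    rw [hid, norm_mul]
    have h15 : 0 ≤ (ell D ^ 15)⁻¹ := inv_nonneg.mpr (pow_nonneg hℓ.le _)
    have hin : ‖innerSum c' χ j d r w - L * circ025 c' D j d r w‖ ≤
        (|C₁| + |C₂|) * (ell D ^ 15)⁻¹ * R := by
      have e24' : ‖innerSum c' χ j d r w - lineInt024 c' χ j d r w‖ ≤ |C₁| * (ell D ^ 15)⁻¹ * R :=
        calc ‖innerSum c' χ j d r w - lineInt024 c' χ j d r w‖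
            ≤ C₁ * (ell D ^ 15)⁻¹ * ∏ q ∈ (d * r).primeFactors, (1 + A / (q : ℝ)) := e24
          _ ≤ |C₁| * (ell D ^ 15)⁻¹ * ∏ q ∈ (d * r).primeFactors, (1 + A / (q : ℝ)) :=
              mul_le_mul_of_nonneg_right (mul_le_mul_of_nonneg_right (le_abs_self _) h15)
                (le_trans zero_le_one (one_le_prod_one_add_div _ hA0))
          _ ≤ |C₁| * (ell D ^ 15)⁻¹ * R := mul_le_mul_of_nonneg_left hRA (mul_nonneg (abs_nonneg _) h15)
      have e25'' : ‖lineInt024 c' χ j d r w - L * circ025 c' D j d r w‖ ≤ |C₂| * (ell D ^ 15)⁻¹ * R :=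
        calc ‖lineInt024 c' χ j d r w - L * circ025 c' D j d r w‖
            ≤ C₂ * (ell D ^ 15)⁻¹ * (∏ q ∈ (d * r).primeFactors, (1 - (q : ℝ)⁻¹)⁻¹) ^ 2 := e25
          _ ≤ |C₂| * (ell D ^ 15)⁻¹ * (∏ q ∈ (d * r).primeFactors, (1 - (q : ℝ)⁻¹)⁻¹) ^ 2 :=
              mul_le_mul_of_nonneg_right (mul_le_mul_of_nonneg_right (le_abs_self _) h15) (sq_nonneg _)
          _ ≤ |C₂| * (ell D ^ 15)⁻¹ * R := mul_le_mul_of_nonneg_left hR6 (mul_nonneg (abs_nonneg _) h15)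
      calc ‖innerSum c' χ j d r w - L * circ025 c' D j d r w‖
          ≤ ‖innerSum c' χ j d r w - lineInt024 c' χ j d r w‖ +
              ‖lineInt024 c' χ j d r w - L * circ025 c' D j d r w‖ :=
            norm_sub_le_norm_sub_add_norm_sub _ _ _
        _ ≤ |C₁| * (ell D ^ 15)⁻¹ * R + |C₂| * (ell D ^ 15)⁻¹ * R := add_le_add e24' e25''
        _ = (|C₁| + |C₂|) * (ell D ^ 15)⁻¹ * R := by ring
    exact mul_le_mul (norm_Xpow_le_small hD3 d r hd hr h1' hw') hin (norm_nonneg _)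
      (Real.exp_pos _).le
  -- holomorphy on a neighbourhood of the closed disc
  have hdiff : DiffContOnCl ℂ E (Metric.ball (0 : ℂ) (alpha D)) := by
    have hsub : Metric.closedBall (0 : ℂ) (alpha D) ⊆ Metric.ball (0 : ℂ) (1.2 * alpha D) :=
      Metric.closedBall_subset_ball (by linarith)
    refine DifferentiableOn.diffContOnCl_ball (U := Metric.ball (0 : ℂ) (1.2 * alpha D)) ?_ hsub
    exact ((differentiable_bracket122 c' χ hD3 j d r hd hr).differentiableOn).sub
      ((differentiableOn_modelInt026 hD3).const_mul _)
  have hderiv := Complex.norm_deriv_le_of_forall_mem_sphere_norm_le hα hdiff hcirc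
  have hBr : DifferentiableAt ℂ (bracket122 c' χ j d r) 0 :=
    (differentiable_bracket122 c' χ hD3 j d r hd hr) 0
  have hM : DifferentiableAt ℂ (modelInt026 D) 0 :=
    (differentiableOn_modelInt026 hD3).differentiableAt
      (Metric.isOpen_ball.mem_nhds (Metric.mem_ball_self (by positivity)))
  have hsplit : deriv E 0 = deriv (bracket122 c' χ j d r) 0 - L * B * deriv (modelInt026 D) 0 := by
    simp only [hE]
    rw [deriv_fun_sub hBr (hM.const_mul _), deriv_const_mul _ hM]
  rw [hsplit, hL, hB] at hderiv
  have hrw : deriv χ.LFunction 1 * PiW χ d r * (betaJ c' D (j + 1) * betaJ c' D (j + 2)) *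
      deriv (modelInt026 D) 0 =
      deriv χ.LFunction 1 * PiW χ d r * betaJ c' D (j + 1) * betaJ c' D (j + 2) *
        deriv (modelInt026 D) 0 := by ring
  rw [hrw] at hderiv
  refine hderiv.trans (le_of_eq ?_)
  rw [alpha_eq_div']
  have h9 : ell D ^ 9 ≠ 0 := pow_ne_zero _ hℓ.ne'
  have h15 : ell D ^ 15 ≠ 0 := pow_ne_zero _ hℓ.ne'
  have h6 : ell D ^ 6 ≠ 0 := pow_ne_zero _ hℓ.ne'
  have hπ : (π : ℝ) ≠ 0 := Real.pi_ne_zero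
  field_simp

/-- **`DedU026readRelA` holds** (packaged). [cite: Zhang2022LandauSiegel, §12 proof of Lemma 12.2, pp.69–70] -/
theorem dedU026readRelA_holds : DedU026readRelA c' :=
  fun h24 h25 => u026readRelA_of_u024RelA_u025Rel c' h24 h25

/-- `DedU026readRelA` — `_holds` alias of `dedU026readRelA_holds` above under the fact's exact name (appended
2026-08-28, D-0026 bookkeeping: the proof term is the existing theorem of this file; no statement,
definition or attribute is edited; no new named fact; the ledger's debt table listed the fact
unproved). [cite: Zhang2022LandauSiegel, §12 proof of Lemma 12.2, pp.69–70] -/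
theorem _root_.Literature.NumberTheory.LFunctions.Zhang2022.Typed.Sec12B.DedU026readRelA_holds :
    DedU026readRelA c' :=
  _root_.Literature.NumberTheory.LFunctions.Zhang2022.Typed.Sec12B.dedU026readRelA_holds (c' := c')

/-- **`DedEq1210L15RelA` holds: (12.10) on `dr ≤ P″₁/T` with error `C𝓛⁻¹⁵·∏_{q∣dr}(1+A/q)` from the
Euler-majorant u026** (u023 = `U023_holds`, u027 = `U027_holds`, `b*`, `log P₁ = 0.504 log P`).
[cite: Zhang2022LandauSiegel, §12 (12.10) pp.69–70] -/
theorem eq1210L15RelA_of_u026readRelA (h26 : U026readRelA c') : Eq1210L15RelA c' := by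
  obtain ⟨C, A, hA0, h26'⟩ := h26
  obtain ⟨D₀, hall⟩ := ((U023_holds c').and h26').and U027_holds
  refine ⟨C / 0.504, A, hA0, max D₀ 3, fun D _ χ hD hq hp hA j hj d r hd hr h1 => ?_⟩
  have hD₀ : D₀ ≤ D := le_trans (le_max_left _ _) hD
  have hD3 : 3 ≤ D := le_trans (le_max_right _ _) hD
  obtain ⟨⟨k23, k26⟩, k27⟩ := hall D χ hD₀ hq hp
  have e23 := k23 j hj d r hd hr
  have e26 := k26 hA j hj d r hd hr h1
  have hℓ : 0 < ell D := by linarith [one_lt_ell hD3]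
  have hlogPeq : Real.log (bigP D) = ell D ^ 9 := by rw [bigP, Real.log_exp]
  have hlogP : 0 < Real.log (bigP D) := by rw [hlogPeq]; exact pow_pos hℓ _
  have hlogP1 : 0 < Real.log (Skeleton.P1 D) := log_P1_pos_three' hD3
  have hlogc : (Real.log (Skeleton.P1 D) : ℂ) ≠ 0 := by exact_mod_cast hlogP1.ne'
  have hlogPc : (Real.log (bigP D) : ℂ) ≠ 0 := by exact_mod_cast hlogP.ne'
  set R : ℝ := ∏ q ∈ (d * r).primeFactors, (1 + A / (q : ℝ)) with hRdef
  set L : ℂ := deriv χ.LFunction 1 * PiW χ d r with hL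
  have hmain : -(1 / (Real.log (Skeleton.P1 D) : ℂ)) *
      (L * betaJ c' D (j + 1) * betaJ c' D (j + 2) * deriv (modelInt026 D) 0) =
        main1210 c' χ j d r := by
    rw [k27, main1210, bstar_eq_display, hL]
    set J : ℂ := ∫ z in (0 : ℝ)..0.004, (z : ℂ) * cexp (3 * π * I * z / 2) with hJ
    have hP1c : (Real.log (Skeleton.P1 D) : ℂ) = 0.504 * (Real.log (bigP D) : ℂ) := by
      rw [log_P1_eq_ell', hlogPeq]; push_cast; ring
    rw [hP1c]
    push_cast
    field_simp
  have hid : sum122 c' χ j d r - main1210 c' χ j d r =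
      -(1 / (Real.log (Skeleton.P1 D) : ℂ)) *
        (deriv (bracket122 c' χ j d r) 0 -
          L * betaJ c' D (j + 1) * betaJ c' D (j + 2) * deriv (modelInt026 D) 0) := by
    rw [e23, ← hmain]; ring
  rw [hid, norm_mul, norm_neg, norm_div, norm_one, Complex.norm_real, Real.norm_eq_abs,
    abs_of_pos hlogP1]
  have hval : 1 / Real.log (Skeleton.P1 D) * (C * (ell D ^ 6)⁻¹ * R) =
      C / 0.504 * (ell D ^ 15)⁻¹ * R := by
    rw [log_P1_eq_ell']
    have h9 : ell D ^ 9 ≠ 0 := pow_ne_zero _ hℓ.ne'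
    have h6 : ell D ^ 6 ≠ 0 := pow_ne_zero _ hℓ.ne'
    have h15 : ell D ^ 15 ≠ 0 := pow_ne_zero _ hℓ.ne'
    field_simp
  calc 1 / Real.log (Skeleton.P1 D) *
        ‖deriv (bracket122 c' χ j d r) 0 -
          L * betaJ c' D (j + 1) * betaJ c' D (j + 2) * deriv (modelInt026 D) 0‖
      ≤ 1 / Real.log (Skeleton.P1 D) * (C * (ell D ^ 6)⁻¹ * R) :=
        mul_le_mul_of_nonneg_left e26 (by positivity)
    _ = C / 0.504 * (ell D ^ 15)⁻¹ * R := hval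

/-- **`DedEq1210L15RelA` holds** (packaged). [cite: Zhang2022LandauSiegel, §12 (12.10) p.70] -/
theorem dedEq1210L15RelA_holds : DedEq1210L15RelA c' :=
  fun h26 => eq1210L15RelA_of_u026readRelA c' h26

/-- `DedEq1210L15RelA` — `_holds` alias of `dedEq1210L15RelA_holds` above under the fact's exact name (appended
2026-08-28, D-0026 bookkeeping: the proof term is the existing theorem of this file; no statement,
definition or attribute is edited; no new named fact; the ledger's debt table listed the fact
unproved). [cite: Zhang2022LandauSiegel, §12 (12.10) p.70] -/
theorem _root_.Literature.NumberTheory.LFunctions.Zhang2022.Typed.Sec12B.DedEq1210L15RelA_holds :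
    DedEq1210L15RelA c' :=
  _root_.Literature.NumberTheory.LFunctions.Zhang2022.Typed.Sec12B.dedEq1210L15RelA_holds (c' := c')

/-- **(12.10) in the Euler-majorant currency from the relative circle claims** (`U024RelA`, `U025Rel`).
[cite: Zhang2022LandauSiegel, §12 (12.10) pp.69–70] -/
theorem eq1210L15RelA_of_u024RelA_u025Rel (h24 : U024RelA c') (h25 : U025Rel c') : Eq1210L15RelA c' :=
  eq1210L15RelA_of_u026readRelA c' (u026readRelA_of_u024RelA_u025Rel c' h24 h25)

/-- **(12.10) in the Euler-majorant currency from `U024Rel`, `U025Rel`** (both in the `(∏(1−q⁻¹)⁻¹)²` currency).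
[cite: Zhang2022LandauSiegel, §12 (12.10) pp.69–70] -/
theorem eq1210L15RelA_of_u024Rel_u025Rel (h24 : U024Rel c') (h25 : U025Rel c') : Eq1210L15RelA c' :=
  eq1210L15RelA_of_u024RelA_u025Rel c' (u024RelA_of_u024Rel c' h24) h25

/-- **`Eq1210LeRel E → Eq1210LeRelA E`**: a bound in the `(∏(1−q⁻¹)⁻¹)²` currency is one in the Euler-majorant
currency with `A = 6` (`Section8FrontEnd44ReductionRel.relFac_le_prod`), for `E ≥ 0`. So an edge out of
`Eq1210L15RelA` serves both currencies. [cite: Zhang2022LandauSiegel, §12 (12.10) p.69] -/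
theorem eq1210LeRelA_of_eq1210LeRel {E : ℕ → ℝ} (hE : ∀ D, 0 ≤ E D) (h : Eq1210LeRel c' E) :
    Eq1210LeRelA c' E := by
  obtain ⟨C, hC⟩ := h
  refine ⟨|C|, 6, by norm_num, hC.mono fun D _ χ _ _ hS hA j hj d r hd hr h1 => ?_⟩
  calc ‖sum122 c' χ j d r - main1210 c' χ j d r‖
      ≤ C * E D * (∏ q ∈ (d * r).primeFactors, (1 - (q : ℝ)⁻¹)⁻¹) ^ 2 := hS hA j hj d r hd hr h1
    _ ≤ |C| * E D * (∏ q ∈ (d * r).primeFactors, (1 - (q : ℝ)⁻¹)⁻¹) ^ 2 :=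
        mul_le_mul_of_nonneg_right (mul_le_mul_of_nonneg_right (le_abs_self C) (hE D)) (sq_nonneg _)
    _ ≤ |C| * E D * ∏ q ∈ (d * r).primeFactors, (1 + 6 / (q : ℝ)) :=
        mul_le_mul_of_nonneg_left (Section8FrontEnd44ReductionRel.relFac_le_prod _)
          (mul_nonneg (abs_nonneg C) (hE D))

/-- **`Eq1210L15Rel → Eq1210L15RelA`** (the case `E = 𝓛⁻¹⁵`). [cite: Zhang2022LandauSiegel, §12 (12.10) p.69] -/
theorem eq1210L15RelA_of_eq1210L15Rel (h : Eq1210L15Rel c') : Eq1210L15RelA c' :=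
  eq1210LeRelA_of_eq1210LeRel c' (fun D => inv_nonneg.mpr (pow_nonneg (Real.log_natCast_nonneg D) 15)) h

end EdgesA

end Literature.NumberTheory.LFunctions.Zhang2022.Typed.Sec12B
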